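import Summits.BirchSwinnertonDyer.BirchSwinnertonDyer.Theorems.KolyvaginRankRigidityAtTwoChebotarevTwoLevel
import HarnessLib

/-!
# Route `KolyvaginRankRigidityAtTwo`, residual crux R_irr `OffHabitatIrredNonSurjTwoConverse`
# (stmt-BirchSwinnertonDyer-27123, LINE 8 «margin absorbs index»): SAH'S LEMMA WITH A GENERAL
# SCALAR — the inflation defect of `H¹(K, E[2^M])` along `K(E[2^{M'}])/K` at FINITE `2`-adic index
# (helper, PROVED, unconditional; width seat `bsd-line-krr2-p2` g9)

On the surjective habitat the KRR Čebotarev engine (`…ChebotarevOneClassAtTwoAlgebra`,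
`…ChebotarevTwoLevel`, `…ChebotarevOneClassAtTwoShifted`) controls the inflation term
`H¹(K(E[2^{M'}])/K, E[2^M])` by ONE bit: `-1 ∈ ρ̄_{E,2^{M'}}(Γ_K)` (`exists_smul_eq_neg_two_pow`,
surjectivity) and Sah at `2` (`two_zsmul_eq_zero_of_h1Eval_eq_zero_of_dvd`). OFF the habitat (the
frame of R_irr: `E(ℚ)[2] = 0`, `2`-adic image of FINITE INDEX, Rouse–Zureick-Brown) `-1` need not
lie in the image, but some SCALAR `1 + 2^{k₀}` always does (Serre's open image theorem: the
`2`-adic image of a non-CM curve contains `1 + 2^{k₀}M₂(ℤ₂)`; tree named fact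
`serre_adicImage_contains_congruenceSubgroup`). This file proves the general-scalar Sah lemma that
turns such a scalar into a UNIFORM bound on the inflation defect — the kernel form of the bet
«`sup_M #H¹(K(E[2^M])/K, E[2^M]) < ∞`» in item 27123's `why it might fail` and of the pen's memo
H1BOUND (evidence on 27123, «not Lean; nothing proved»):

* `sub_one_zsmul_eq_zero_of_h1Eval_eq_zero_of_smul_eq` — if `n ∣ n'`, some `z ∈ Γ_k` acts on
  `E[n']` as the integer `s`, and `x ∈ H¹(k, E[n])` vanishes on `Γ_{k(E[n'])}`, then `(s - 1) x = 0`;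
* `pow_zsmul_eq_zero_of_h1Eval_eq_zero_of_smul_eq_one_add` — `s = 1 + 2^e`: the defect is `≤ e`
  bits, uniformly in the levels `n ∣ n'`;
* `inflationDefect_one_of_hasSurjectiveModNGaloisRep` — the habitat instance `e = 1`, in the
  shape of the hypothesis `hSah` of the finite-index Čebotarev theorem
  (`…OffHabitatIrredChebotarevOneClassFiniteIndex`:
  `exists_kolyvaginPrime_gt_two_eigenclass_of_inflationDefect`, loss `k + 1` bits).

HONEST FRAMING: helper lemmas (`--supports` 27123); nothing here closes R_irr, U1 28083 or the print
item 23091; BSD is NOT proved by any of this.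

References: [Sah1968] Prop. 2.7 (b); [GrossLMS1991] §9 Prop. 9.1 (proof); [LawsonWuthrich2016]
Lemma 3; [SilvermanAEC2009] Thm. III.7.9 (a); [Kolyvagin1991MathAnn] §2 (Kolyvagin works at
finite index); [RouseZureickBrown2015].
-/

set_option autoImplicit false
-- the Theorems namespace of this sub repeats the summit name by design (D-0017 nested layout)
set_option linter.dupNamespace false

noncomputable section

open scoped Classical Pointwise

namespace Summit.BirchSwinnertonDyer.BirchSwinnertonDyer.Theorems.KolyvaginLowerBoundAtTwo

open WeierstrassCurve Field NumberField IsDedekindDomain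
open Literature.NumberTheory.GaloisRepresentations Literature.NumberTheory.EllipticCurves
open Literature.NumberTheory Rat.HeightOneSpectrum

universe u

/-! ### Sah with a general scalar, two levels -/

section Sah

/-- **Sah's lemma with a general scalar, two levels.** If `n ∣ n'`, some `z ∈ Γ_k` acts on
`E(k̄)[n']` as multiplication by the integer `s`, and a class `x ∈ H¹(k, E[n])` vanishes on
`Γ_{k(E[n'])}` (`[x, ρ] = 0` there), then `(s - 1) • x = 0`. (For a cocycle `φ` of `x` and any `g`,
the commutator `z⁻¹g⁻¹zg` fixes `E[n']`, so `φ(zg) = φ(gz)`, i.e. `(s - 1)φ(g) = gφ(z) - φ(z)` is a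
coboundary.) The tree's `two_zsmul_eq_zero_of_h1Eval_eq_zero_of_dvd` is the case `s = -1`.
[cite: Sah1968, Prop. 2.7 (b)] [cite: GrossLMS1991, Prop. 9.1 (proof)] -/
theorem sub_one_zsmul_eq_zero_of_h1Eval_eq_zero_of_smul_eq {k : Type u} [Field k]
    (V : WeierstrassCurve k) {n n' : ℤ} (hnn' : n ∣ n') {z : absoluteGaloisGroup k} {s : ℤ}
    (hz' : ∀ P : geomTorsion V n', z • P = s • P) {x : galH1Torsion V n}
    (hx : ∀ ρ ∈ torsionFixing V n', h1Eval V n x ρ = 0) : (s - 1) • x = 0 := by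
  have hz : ∀ P : geomTorsion V n, z • P = s • P := fun P ↦ by
    have := hz' (AddSubgroup.inclusion (V.geomTorsion_le_of_dvd hnn') P)
    apply Subtype.ext
    exact congrArg (fun x : geomTorsion V n' ↦ (x : geomPoints V)) this
  have hzinv : ∀ P : geomTorsion V n', z⁻¹ • s • P = P := fun P ↦ by
    rw [smul_comm z⁻¹ s]
    have := hz' (z⁻¹ • P)
    rw [smul_inv_smul] at this
    exact this.symm
  -- `(s - 1) • x` is the class of the cocycle `(s - 1) • φ`
  have hcl : (s - 1) • x = oneCocycleClass _ ((s - 1) • reprCocycle V n x) := by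
    have h : oneCocycleClass _ ((s - 1) • reprCocycle V n x) =
        (s - 1) • oneCocycleClass _ (reprCocycle V n x) :=
      map_zsmul (oneCocycleClassₗ (discreteTopRep (absoluteGaloisGroup k) (geomTorsion V n)))
        (s - 1) (reprCocycle V n x)
    rw [oneCocycleClass_reprCocycle] at h
    exact h.symm
  rw [hcl]
  set φ := reprCocycle V n x with hφ
  refine (oneCocycleClass_eq_zero_iff _ ((s - 1) • φ)).mpr ⟨φ.1 z, fun g ↦ ?_⟩
  -- `n₀ = z⁻¹ g⁻¹ z g` acts trivially on `E[n']`
  have hn₀ : z⁻¹ * g⁻¹ * z * g ∈ torsionFixing V n' := by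
    refine (mem_torsionFixing_iff V n').mpr fun P ↦ ?_
    rw [mul_smul, mul_smul, mul_smul, hz' (g • P), smul_comm g⁻¹ s, inv_smul_smul, hzinv]
  have hzg : z * g = g * z * (z⁻¹ * g⁻¹ * z * g) := by group
  have h1 := φ.2 z g
  have h2 := φ.2 (g * z) (z⁻¹ * g⁻¹ * z * g)
  have h3 := φ.2 g z
  rw [discreteTopRep_ρ_apply] at h1 h2 h3
  have h4 : φ.1 (z⁻¹ * g⁻¹ * z * g) = 0 := hx _ hn₀
  rw [← hzg, h1, h4, smul_zero, add_zero, h3, hz] at h2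
  -- `h2 : φ z + s • φ g = φ g + g • φ z`
  have key : s • φ.1 g - φ.1 g = g • φ.1 z - φ.1 z := by
    have e : s • φ.1 g - φ.1 g - (g • φ.1 z - φ.1 z) =
        (φ.1 z + s • φ.1 g) - (φ.1 g + g • φ.1 z) := by abel
    rw [← sub_eq_zero, e, h2, sub_self]
  have hval : ((s - 1) • φ).1 g = (s - 1) • φ.1 g := rfl
  have hfin : (s - 1) • φ.1 g = s • φ.1 g - φ.1 g := by
    rw [sub_eq_add_neg, add_zsmul, neg_one_zsmul, ← sub_eq_add_neg]
  rw [hval, discreteTopRep_ρ_apply, hfin, key]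

/-- **Inflation defect `≤ e` bits from ONE scalar `1 + 2^e` in the image.** If `n ∣ n'` and some
`z ∈ Γ_k` acts on `E(k̄)[n']` as multiplication by `1 + 2^e`, then every class of `H¹(k, E[n])`
vanishing on `Γ_{k(E[n'])}` is killed by `2^e`. (At finite `2`-adic index `2^{k₀}` — the image
contains `1 + 2^{k₀}M₂(ℤ₂)`, in particular the scalar `1 + 2^{k₀}` — this is the uniform bound on
`H¹(K(E[2^{M'}])/K, E[2^M])` that LINE 8 bets on.) [cite: Sah1968, Prop. 2.7 (b)]
[cite: SilvermanAEC2009, Thm. III.7.9 (a)] -/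
theorem pow_zsmul_eq_zero_of_h1Eval_eq_zero_of_smul_eq_one_add {k : Type u} [Field k]
    (V : WeierstrassCurve k) {n n' : ℤ} (hnn' : n ∣ n') {z : absoluteGaloisGroup k} {e : ℕ}
    (hz' : ∀ P : geomTorsion V n', z • P = ((1 + 2 ^ e : ℕ) : ℤ) • P) {x : galH1Torsion V n}
    (hx : ∀ ρ ∈ torsionFixing V n', h1Eval V n x ρ = 0) : (2 : ℤ) ^ e • x = 0 := by
  have h := sub_one_zsmul_eq_zero_of_h1Eval_eq_zero_of_smul_eq V hnn' hz' hx
  have e1 : ((1 + 2 ^ e : ℕ) : ℤ) - 1 = (2 : ℤ) ^ e := by push_cast; ring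
  rwa [e1] at h

/-- **The habitat instance `k = 1`.** For `W/ℚ` with `ρ̄_{W,2^{M'}}` onto and `[K:ℚ] = 2`, some
`z ∈ Γ_K` acts as `-1` on `E[2^{M'}]` (`exists_smul_eq_neg_two_pow`), so a class of
`H¹(K, E[2^M])`, `M ≤ M'`, vanishing on `Γ_{K(E[2^{M'}])}` is killed by `2 = 2^1`
(`two_zsmul_eq_zero_of_h1Eval_eq_zero_of_dvd`). [cite: GrossLMS1991, §9 Prop. 9.1]
[cite: Sah1968, Prop. 2.7 (b)] -/
theorem inflationDefect_one_of_hasSurjectiveModNGaloisRep (W : WeierstrassCurve ℚ) [W.IsElliptic]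
    {K : Type u} [Field K] [NumberField K] (hK2 : Module.finrank ℚ K = 2) {M M' : ℕ}
    (hM' : 1 ≤ M') (hMM' : M ≤ M') (hρ : W.HasSurjectiveModNGaloisRep ((2 ^ M' : ℕ) : ℤ))
    (x : galH1Torsion (W.baseChange K) ((2 ^ M : ℕ) : ℤ))
    (hx : ∀ ρ ∈ torsionFixing (W.baseChange K) ((2 ^ M' : ℕ) : ℤ),
      h1Eval (W.baseChange K) ((2 ^ M : ℕ) : ℤ) x ρ = 0) :
    (2 : ℤ) ^ 1 • x = 0 := by
  have hdvd : ((2 ^ M : ℕ) : ℤ) ∣ ((2 ^ M' : ℕ) : ℤ) := by exact_mod_cast Nat.pow_dvd_pow 2 hMM'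
  obtain ⟨z, hz⟩ := exists_smul_eq_neg_two_pow W hK2 hM' hρ
  rw [pow_one]
  exact two_zsmul_eq_zero_of_h1Eval_eq_zero_of_dvd (W.baseChange K) hdvd hz hx

end Sah

end Summit.BirchSwinnertonDyer.BirchSwinnertonDyer.Theorems.KolyvaginLowerBoundAtTwo

end
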